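import Summits.BirchSwinnertonDyer.BirchSwinnertonDyer.Theorems.SignedLowerHalvesSprungLowerDivisibilityAtThreeCyclotomicCommonZeroTheta
import Summits.BirchSwinnertonDyer.BirchSwinnertonDyer.Theorems.SignedLowerHalvesSprungLowerDivisibilityAtThreeCyclotomicCertOfLambda
import Summits.BirchSwinnertonDyer.BirchSwinnertonDyer.Theorems.SignedLowerHalvesSprungLowerDivisibilityAtThreeBothColours
import HarnessLib

/-!
# Crux `SprungLowerDivisibilityAtThree` (item stmt-BirchSwinnertonDyer-19875), line `chromatic-common-zeros`, stub S4b-cyc: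
# the FINITE BIRCH CERTIFICATE DOOR — `λ`-bound for the large levels, one non-vanishing Birch sum per small level

Cell `bsd-ssimc` (host) / lead `cruxlead-stmt-BirchSwinnertonDyer-19875` (g3); `--supports` 19875 `--as helper`; theorems only;
closes NO item; K1 / S4b-cyc / BSD / leaf X8 are NOT proved by anything here.

The registered stub S4b-cyc `stub_cyclotomicLowerPosLevel` (skeleton v8) asks for the local Eisenstein inequality at a
height-one prime `𝔭 ∋ Φ_{3^j}(1+T)`, `j ≥ 1`, containing the Néron-normalised `L`-function of BOTH colours. By
`cyclotomic_comp_dvd_of_cyclotomicCommonZero` (p623344) such a `𝔭` forces `Φ_{3^j}(1+T) ∣ L♯` and `∣ L♭`; this file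
shows that for a GIVEN X8 pair a FINITE certificate excludes every such `𝔭`, so the stub holds for that pair vacuously,
at EVERY analytic rank:

* large levels: `Φ_{p^j}(1+T) ∣ L ≠ 0` forces `φ(p^j) ≤ λ(L)` (w2 g3's `not_cyclotomic_comp_dvd_of_lam_lt`, p623422,
  `…CyclotomicCertOfLambda`); both colours are non-zero on X8 (`ClassX8.sharp_ne_zero_and_flat_ne_zero`, w3 g2, p621881), so
  every level `j > j₀` with `λ(L♯) < φ(p^{j₀+1})` or `λ(L♭) < φ(p^{j₀+1})` is excluded;
* small levels `1 ≤ j ≤ j₀`: ONE even `p`-power-order character `χ_j` mod `p^{j+e₀}` with `χ_j(γ)` primitive of order `p^j`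
  and non-vanishing Birch sum `∑_a χ_j(a)[a/p^{j+e₀}]⁺_f ≠ 0` (`not_cyclotomic_common_dvd_of_ratTwistedSymbolSum_ne_zero`,
  p623344 — exact rational modular-symbol data; by Birch's formula: `L(E, χ̄_j, 1) ≠ 0`).

`stub_cyclotomicLowerPosLevel_of_birchCert` = the S4b-cyc binder telescope VERBATIM with the two certificate hypotheses
displayed after the guard, CONDITIONAL on the period unit `h3` only. Compared with w2 g3's `cyclotomicCert_of_lamCert`
(p623422), whose low-level datum is «`Φ_{p^j}(1+T) ∤ L^{•}` for some colour» (an exact `3`-adic fact about `L^•`), the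
low-level datum here is a RATIONAL one — a non-vanishing Birch sum, i.e. a twisted `L`-value — which needs no `3`-adic
approximation of `L♯`, `L♭` at all. On the x8 census `λ♯, λ♭ ≤ 4` in 215/217 cells, so
`j₀ ≤ 1` there (one cubic character of conductor 9 per cell, or none when `min λ < 2`); this is bookkeeping for the x8 pen,
not a claim made here.

References: [Sprung2017] Cor. 4.4–4.5, Thm. 1.12; [MazurTateTeitelbaum1986Invent] §I.8 (8.6), §I.13; [Washington1997] §7.1–7.2
(λ = Weierstrass degree; zeros in the open disc); [Sprung2015] Prop. 5.2, Conj. 5.6; [KuriharaPollack2007] Problem 3.2.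
-/

set_option linter.dupNamespace false
set_option autoImplicit false

noncomputable section

open scoped Classical NumberField MatrixGroups ModularForm Polynomial

open NumberField IsDedekindDomain CongruenceSubgroup WeierstrassCurve Field Polynomial
  Literature.NumberTheory.EllipticCurves Literature.NumberTheory.EllipticCurves.ModularForms
  Literature.NumberTheory.EllipticCurves.ZpExtension Literature.NumberTheory.EllipticCurves.Sprung2017
  Literature.NumberTheory.EllipticCurves.Sprung2012 Literature.NumberTheory.EllipticCurves.Rank1Residual
  Literature.NumberTheory.EllipticCurves.IwasawaAlgebra
  Summit.BirchSwinnertonDyer.Rank1Residual.X1.MuLambda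
  Summit.BirchSwinnertonDyer.BirchSwinnertonDyer.Theorems.ChromaticBothColours

namespace Summit.BirchSwinnertonDyer.BirchSwinnertonDyer.Theorems.ChromaticCommonZeros

/-! ### The finite Birch certificate door for S4b-cyc (per pair, every analytic rank) -/

section Door

/-- **Stub S4b-cyc `stub_cyclotomicLowerPosLevel` for a pair with a FINITE BIRCH CERTIFICATE — VACUOUSLY, at every
analytic rank.** The registered binder telescope of S4b-cyc (skeleton v8, sha16 2f563411) with two extra displayed
hypotheses after the guard: a level bound `j₀` with `λ(L♯) < φ(p^{j₀+1}) ∨ λ(L♭) < φ(p^{j₀+1})`, and for each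
`1 ≤ j ≤ j₀` an even `p`-power-order character `χ` mod `p^{j+e₀}` (values in `ℂ_p`), `χ(γ)` primitive of order `p^j`,
with `∑_a χ(a)[a/p^{j+e₀}]⁺_f ≠ 0`. Then the local Eisenstein inequality at any height-one `𝔭 ∋ Φ_{p^j}(1+T)` (`j ≥ 1`,
`T ∉ 𝔭`) containing both Néron-normalised colours holds because no such `𝔭` exists: it would force `Φ_{p^j}(1+T) ∣ L♯`
and `∣ L♭` (`cyclotomic_comp_dvd_of_cyclotomicCommonZero`), excluded for `j ≤ j₀` by the Birch sum
(`not_cyclotomic_common_dvd_of_ratTwistedSymbolSum_ne_zero`) and for `j > j₀` by the `λ`-bound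
(`not_cyclotomic_comp_dvd_of_lam_lt`, p623422; both colours are non-zero on X8, `ClassX8.sharp_ne_zero_and_flat_ne_zero`). CONDITIONAL on the displayed named fact `h3` (period unit)
only; no main-conjecture input. [cite: Sprung2017, Cor. 4.4–4.5, Thm. 1.12 and Thm. 4.13]
[cite: MazurTateTeitelbaum1986Invent, §I.8 (8.6), §I.13] [cite: Washington1997, §7.1–7.2] [cite: Sprung2015, Conj. 5.6] -/
theorem stub_cyclotomicLowerPosLevel_of_birchCert (h3 : realPeriodRat_eq_unit_mul_plusPeriod_three) :
    ∀ (W : WeierstrassCurve ℚ) [W.IsElliptic] [W.IsGloballyMinimal] (p : ℕ) [Fact p.Prime]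
      [ContinuousSMul ℤ_[p] (W.tateModule p)] [Module.Free ℤ_[p] (W.tateModule p)]
      [Module.Finite ℤ_[p] (W.tateModule p)],
      ClassX8 W p → ∀ (col : Chroma) (κ : ZpExtension ℚ p) (γ : Field.absoluteGaloisGroup ℚ),
      κ.IsCyclotomic → κ.IsTopGenerator γ → IsCyclotomicVariable p γ →
    ∀ (v : HeightOneSpectrum (𝓞 ℚ)), (p : 𝓞 ℚ) ∈ v.asIdeal →
    ∀ (g : Field.absoluteGaloisGroup (v.adicCompletion ℚ)),
      κ.IsTopGenerator (resGalOfEmb (closureEmb (K := ℚ) (v.adicCompletion ℚ)) g) →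
    ∀ (cneg : localPoints W (v.adicCompletion ℚ)) (c : ℕ → localPoints W (v.adicCompletion ℚ)),
      IsHondaSystem κ (closureEmb (K := ℚ) (v.adicCompletion ℚ)) W (W.frobeniusTrace p) g cneg c →
    ∀ (N : ℕ) (_ : NeZero N) (f : CuspForm (Gamma0 N) 2) (ϖ : ℚ) (Lsharp Lflat : IwasawaAlgebra p),
      IsNewformOf W f → (ϖ : ℝ) * W.realPeriodRat = plusPeriod f →
      IsSprungPair f p (W.frobeniusTrace p) Lsharp Lflat → chromaticL col Lsharp Lflat ≠ 0 →
    -- the finite Birch certificate of the pair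
    ∀ (j₀ : ℕ), (lam Lsharp < Nat.totient (p ^ (j₀ + 1)) ∨ lam Lflat < Nat.totient (p ^ (j₀ + 1))) →
      (∀ j : ℕ, 1 ≤ j → j ≤ j₀ →
        ∃ χ : DirichletCharacter ℂ_[p] (p ^ (j + cyclotomicExponent p)), χ.Even ∧
          (∃ i : ℕ, orderOf χ = p ^ i) ∧
          IsPrimitiveRoot (χ (cyclotomicGenerator p : ZMod (p ^ (j + cyclotomicExponent p)))) (p ^ j) ∧
          ratTwistedSymbolSum f χ ≠ 0) →
    ∀ (D : SharpFlatSelmerDualData W κ γ (closureEmb (K := ℚ) (v.adicCompletion ℚ))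
        (W.frobeniusTrace p) g c col) [Module.Finite (IwasawaAlgebra p) D.X],
      Module.IsTorsion (IwasawaAlgebra p) D.X →
    ∀ (G : IwasawaAlgebra p),
      iwasawaToPowerSeries p G =
        PowerSeries.C (ϖ : ℚ_[p]) * iwasawaToPowerSeries p (chromaticL col Lsharp Lflat) →
    ∀ (I : Kato2004.IwasawaH1Data W p κ γ)
      (Cs : SharpFlatColemanKatoData W p f ϖ κ γ (closureEmb (K := ℚ) (v.adicCompletion ℚ))
        (W.frobeniusTrace p) g c Chroma.sharp I)
      (Cf : SharpFlatColemanKatoData W p f ϖ κ γ (closureEmb (K := ℚ) (v.adicCompletion ℚ))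
        (W.frobeniusTrace p) g c Chroma.flat I),
      Cs.Z = Cf.Z →
    ∀ 𝔭 : PrimeSpectrum (IwasawaAlgebra p), 𝔭.asIdeal.height = 1 →
      (PowerSeries.X : IwasawaAlgebra p) ∉ 𝔭.asIdeal →
      (∃ j : ℕ, 1 ≤ j ∧
        ((((Polynomial.cyclotomic (p ^ j) ℤ).comp (Polynomial.X + 1)).map (Int.castRingHom ℤ_[p]) : Polynomial ℤ_[p]) :
          PowerSeries ℤ_[p]) ∈ 𝔭.asIdeal) →
      (∀ (col' : Chroma) (G' : IwasawaAlgebra p),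
        iwasawaToPowerSeries p G' =
          PowerSeries.C (ϖ : ℚ_[p]) * iwasawaToPowerSeries p (chromaticL col' Lsharp Lflat) →
        G' ∈ 𝔭.asIdeal) →
      Module.lengthAt (IwasawaAlgebra p) (IwasawaAlgebra p ⧸ Ideal.span {G}) 𝔭 ≤
        Module.lengthAt (IwasawaAlgebra p) D.X 𝔭 := by
  intro W _ _ p _ _ _ _ hX col κ γ _ _ _ v _ g _ cneg c _ N hN f ϖ Lsharp Lflat hf hϖ hSP _ j₀ hlam hcert
    D _ _ G _ I Cs Cf _ 𝔭 h𝔭 _ hΦ hcommon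
  haveI : NeZero N := hN
  exfalso
  obtain ⟨j, hj1, hΦj⟩ := hΦ
  -- both colours are divisible by `Φ_{p^j}(1+T)`
  obtain ⟨hs, hfl⟩ := cyclotomic_comp_dvd_of_cyclotomicCommonZero h3 W p hX f hf ϖ hϖ Lsharp Lflat hSP 𝔭 h𝔭
    hj1 hΦj hcommon
  by_cases hjj : j ≤ j₀
  · -- small level: the Birch sum certificate
    obtain ⟨χ, hev, hord, hζ, hne⟩ := hcert j hj1 hjj
    exact not_cyclotomic_common_dvd_of_ratTwistedSymbolSum_ne_zero hSP χ hev hord hζ hne ⟨hs, hfl⟩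
  · -- large level: the `λ`-bound, for the colour with small `λ` (both colours are non-zero on X8)
    obtain ⟨k, rfl⟩ : ∃ k, j = k + 1 := ⟨j - 1, by omega⟩
    have hk : j₀ ≤ k := by omega
    obtain ⟨hs0, hf0⟩ := ClassX8.sharp_ne_zero_and_flat_ne_zero W p hX N hN f Lsharp Lflat hf hSP
    have hmono : (p ^ (j₀ + 1)).totient ≤ (p ^ (k + 1)).totient := totient_prime_pow_mono (by omega)
    rcases hlam with hls | hlf
    · exact not_cyclotomic_comp_dvd_of_lam_lt hs0 k (lt_of_lt_of_le hls hmono) hs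
    · exact not_cyclotomic_comp_dvd_of_lam_lt hf0 k (lt_of_lt_of_le hlf hmono) hfl

end Door

end Summit.BirchSwinnertonDyer.BirchSwinnertonDyer.Theorems.ChromaticCommonZeros

end
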